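import Summits.QuantumFields.YangMills.Theorems.UnitScaleTiltProp7SectET3DeltaOneT3JTerm
import Summits.QuantumFields.YangMills.Theorems.UnitScaleTiltProp7SectET3WilsonHessianT3Rows
import Summits.QuantumFields.YangMills.Theorems.UnitScaleTiltProp7SectET3CurvedPropagatorsT3Rows
import Summits.QuantumFields.YangMills.Theorems.UnitScaleTiltProp7QTwSHessianReality
import HarnessLib

/-!
# Route `UnitScaleTilt`, crux «MinimiserStabilityRegPr» (stmt-QuantumFields-19200, stub EX) ∕ (O″χ) B0 (stmt-QuantumFields-20520), node N06(d = 3), route (α) —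
# LAYER 0, ROWS OF BRICK L0b PART 4 (def-free): **THE REPARAMETRISATION CERTIFICATE OF THE J-TERM — `Δ^η + T_J` IS THE HESSIAN OF THE ACTION IN THE CHART THAT LINEARISES THE AVERAGING
# CONSTRAINT** ([Balaban1985BackgroundPropagators] p.421 L8–11, (3.127)): for `Φ_H(X) := X − ½·H(2C⁽²⁾[X, X])`, `H = H46 U₀`, one has `D²(𝒜 ∘ Φ_H)(0)[X, Y] = hessFormRe X Y + tjForm X Y` and, on the
# class where `Q∘H = 1`, `D²(log U̿^{twS} ∘ Φ_H)(0)[X, Y] = 0` (given Schwarz symmetry of `C⁽²⁾`, ✓`fderiv_fderiv_logChartTwS_symm_of_regPr` at `RegPr`)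

Cell `ym-inputs` (desk `pub/ym-inputs`, INPUT-LIST.md v11 §4 row p01).  THEOREMS ONLY (0 `def`, 0 `sorry`); `--supports stmt-QuantumFields-20520 --as helper`; count-neutral.  YM₃ on T³ is ladder rung R3, NOT the
Clay problem; nothing here is a claim about a stub, a crux, d = 4 or the mass gap.

THE PRINT.  p. 421 L8–11: «the non-linear averaging operations have to be linearized, and a linearizing transformation creates new quadratic terms in an expansion of the action … connected with
the linear term in the expansion (3.12)»; (3.127): the quadratic form `⟨A, ΔA⟩ − 2⟨HC⁽²⁾(A), J⟩`.

THE MATHEMATICS.  `Φ(Z) := Z − ½·H(q(Z, Z))` with `q := avgHess U₀ = D²(log U̿^{twS})(0)` and `H := H46 U₀` is a polynomial map with `Φ(0) = 0`, `DΦ(0) = 1`, `D²Φ(0)[X, Y] = −½·H(q[X, Y] + q[Y, X])`.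
For any `C²` function `f`: `D²(f ∘ Φ)(0)[X, Y] = D²f(0)[X, Y] + Df(0)[D²Φ(0)[X, Y]]` (`HasFDerivAt.clm_comp` on `Z ↦ Df(Φ Z) ∘ DΦ(Z)`).  With `f = 𝒜 := actionRe ∘ chartU U₀` this is
`hessFormRe X Y − ½·actionGrad(H(q[X,Y] + q[Y,X]))` `= hessFormRe X Y + ½(tjForm X Y + tjForm Y X)`, `= hessFormRe X Y + tjForm X Y` when `q` is symmetric; with `f = log U̿^{twS}` (analytic near
`0` at `RegPr`) it is `q[X,Y] − ½·Q(H(q[X,Y] + q[Y,X])) = ½(q[X,Y] − q[Y,X])` on the class `Q∘H = 1` (✓`QTwS_Hf`), `= 0` when `q` is symmetric: the constraint is linear to second order.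

WHAT IS PROVED: §1 frame-free `hasFDerivAt_bilin_diag` (`Z ↦ B Z Z`), ★`fderiv_fderiv_comp_of_deriv_id` (`D²(f∘Φ)(0)[X,Y] = f″[X,Y] + Df(0)[Φ″[X,Y]]` for `Φ 0 = 0`, `DΦ(0) = 1`); §2 the jets of
`Φ_H`: `hasFDerivAt_reparamJ`, `fderiv_reparamJ_eq`, `fderiv_reparamJ_zero`, `hasFDerivAt_fderiv_reparamJ`, `reparamJ_snd_apply`; §3 ★★★`fderiv_fderiv_actionRe_comp_reparamJ` (`= hessFormRe X Y + ½(tjForm X Y + tjForm Y X)`,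
no hypothesis), ★★★`hessFormRe_add_tjForm_eq (hAs)` (`hessFormRe + tjForm = D²(𝒜 ∘ Φ_H)(0)`), ★★★`fderiv_fderiv_logChartTwS_comp_reparamJ (hp) (hρ) (hL)` (`= ½(q[X,Y] − q[Y,X])`), ★★★`reparamJ_certificate_of_regPr
(hε₀ he hWe hWε) (hreg) (hp)` (both facts at `U₀ ∈ 𝔘_k(ε₀)`: the action's Hessian in `Φ_H` is `h + t_J` ∧ the averaging has no quadratic term).
HONEST SCOPE.  Calculus bookkeeping certifying the DEFINITION ✓`tjForm`∕`TJ` against print's sentence; no estimate; nothing of print asserted; N06 NOT discharged; no stub closed.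

References: T. Bałaban, CMP **99** (1985) 389–434 [Balaban1985BackgroundPropagators] (p.421 L4–11, (3.127)–(3.128) p.421, (3.12)–(3.14) pp.392–393); CMP **102** (1985) 277–309 [Balaban1985Variational]
((47)–(49) p.285 — the same reparametrisation `A = A′ − HD(A′)` for the first variation).
-/

set_option autoImplicit false

noncomputable section

open scoped InnerProductSpace ComplexConjugate Matrix.Norms.L2Operator BigOperators
open Metric Set Filter Topology

namespace Summit.QuantumFields.YangMills.Theorems.Prop7SectET3DeltaOne

open Literature.MathematicalPhysics.QuantumFieldTheory.Balaban1983to89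
open Literature.MathematicalPhysics.QuantumFieldTheory.Balaban1983to89.T3ContinuumYM3Torus
open T3SectALandauChart (eta eta_pos)
open T3PrintedRegularMinimiser (RegPr)
open B11Eq103H1Complex (BondL2K)
open Summit.QuantumFields.YangMills.Theorems.Prop7SectET3Transport (periodsT3)
open Summit.QuantumFields.YangMills.Theorems.Prop7SectET3HilbertLetters (W₂ toL2)
open Summit.QuantumFields.YangMills.Theorems.Prop7SectET3CurvedPropagators (PosOnto Hf QTwS_Hf)
open Summit.QuantumFields.YangMills.Theorems.Prop7SectET3WilsonHessian (chartU actionRe hessFormRe DeltaEta contDiff_actionRe_chartU)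
open Summit.QuantumFields.YangMills.Theorems.Prop7SectET3DeltaPi (DeltaPiSlot H46)
open Summit.QuantumFields.YangMills.Theorems.Prop7SymAvgTwSym (logChartTwS QTwS QTwS_def)
open Summit.QuantumFields.YangMills.Theorems.Prop7CmapTwSymInputs (analyticOnNhd_logChartTwS)
open Summit.QuantumFields.YangMills.Theorems.Prop7QTwSHessianReality (fderiv_fderiv_logChartTwS_symm_of_regPr)

/-! ## §1 Frame-free second-order chain rule through a chart with `Φ 0 = 0`, `DΦ(0) = 1` -/

section FrameFree

variable {E F G : Type*} [NormedAddCommGroup E] [NormedSpace ℂ E] [NormedAddCommGroup F] [NormedSpace ℂ F] [NormedAddCommGroup G] [NormedSpace ℂ G]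

/-- The diagonal of a continuous bilinear map is differentiable: `D(Z ↦ B Z Z)(Z₀) = B Z₀ + Bᵀ Z₀`. [folklore] -/
theorem hasFDerivAt_bilin_diag (B : E →L[ℂ] E →L[ℂ] F) (Z₀ : E) :
    HasFDerivAt (fun Z => B Z Z) (B Z₀ + B.flip Z₀) Z₀ := by
  have h := (B.hasFDerivAt (x := Z₀)).clm_apply (hasFDerivAt_id Z₀)
  simpa only [ContinuousLinearMap.comp_id, id_eq, add_comm] using h

/-- ★ **SECOND-ORDER CHAIN RULE THROUGH A TANGENT-TO-IDENTITY CHART**: if `Φ 0 = 0`, `Φ` is differentiable everywhere with `DΦ(0) = 1` and `Z ↦ DΦ(Z)` has derivative `Φ″` at `0`, and `f` is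
differentiable near `0 = Φ 0` with `Z ↦ Df(Z)` differentiable at `0` with derivative `f″`, then `D²(f ∘ Φ)(0)[X, Y] = f″[X, Y] + Df(0)[Φ″[X, Y]]`. [folklore] -/
theorem fderiv_fderiv_comp_of_deriv_id {Φ : E → E} {f : E → F} {Φ'' : E →L[ℂ] E →L[ℂ] E} {f'' : E →L[ℂ] E →L[ℂ] F}
    (hΦ0 : Φ 0 = 0) (hΦd : ∀ Z, DifferentiableAt ℂ Φ Z) (hΦ1 : fderiv ℂ Φ 0 = ContinuousLinearMap.id ℂ E)
    (hΦ2 : HasFDerivAt (fun Z => fderiv ℂ Φ Z) Φ'' 0)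
    (hfd : ∀ᶠ Z in 𝓝 (0 : E), DifferentiableAt ℂ f (Φ Z)) (hf2 : HasFDerivAt (fun W => fderiv ℂ f W) f'' 0) (X Y : E) :
    fderiv ℂ (fun Z => fderiv ℂ (f ∘ Φ) Z) 0 X Y = f'' X Y + fderiv ℂ f 0 (Φ'' X Y) := by
  -- near `0`, `D(f∘Φ)(Z) = Df(Φ Z) ∘ DΦ(Z)`
  have hev : (fun Z => fderiv ℂ (f ∘ Φ) Z) =ᶠ[𝓝 0] fun Z => (fderiv ℂ f (Φ Z)).comp (fderiv ℂ Φ Z) := by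
    filter_upwards [hfd] with Z hZ
    exact fderiv_comp Z hZ (hΦd Z)
  rw [hev.fderiv_eq]
  -- differentiate the product `Z ↦ Df(Φ Z) ∘ DΦ(Z)` at `0`
  have hΦat : HasFDerivAt Φ (ContinuousLinearMap.id ℂ E) 0 := by rw [← hΦ1]; exact (hΦd 0).hasFDerivAt
  have hc : HasFDerivAt (fun Z => fderiv ℂ f (Φ Z)) (f''.comp (ContinuousLinearMap.id ℂ E)) 0 := by
    have h2 : HasFDerivAt (fun W => fderiv ℂ f W) f'' (Φ 0) := by rw [hΦ0]; exact hf2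
    exact h2.comp 0 hΦat
  rw [ContinuousLinearMap.comp_id] at hc
  have key := (hc.clm_comp hΦ2).fderiv
  rw [key, hΦ1, hΦ0]
  simp only [add_apply, ContinuousLinearMap.comp_apply, ContinuousLinearMap.compL_apply, ContinuousLinearMap.flip_apply, ContinuousLinearMap.comp_id]
  rw [add_comm]

end FrameFree

/-! ## §2 The constraint-linearising chart `Φ_H(Z) = Z − ½·H(q[Z, Z])` and its jets at `0` -/

section Chart

variable {F : T3Family} {n K : ℕ} {h : n ≤ K} {c₀ cB a : ℝ} [Fact (0 < c₀)] [Fact (0 < cB)]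
variable (U₀ : GaugeField (F.P K) 0 (Matrix.specialUnitaryGroup (Fin 2) ℂ))

/-- **THE JETS OF `Φ_H(Z) := Z − ½·H46(avgHess Z Z)` AT EVERY POINT**: `DΦ_H(Z₀) = 1 − ½·H46 ∘ (q[Z₀, ·] + q[·, Z₀])`. [cite: Balaban1985BackgroundPropagators, (3.127) p.421; Balaban1985Variational, (47)–(48) p.285] -/
theorem hasFDerivAt_reparamJ (Z₀ : PBond (F.P K) 0 → Matrix (Fin 2) (Fin 2) ℂ) :
    HasFDerivAt (fun Z : PBond (F.P K) 0 → Matrix (Fin 2) (Fin 2) ℂ => Z - (2 : ℂ)⁻¹ • H46L F n K h c₀ cB a U₀ (avgHess F n K h U₀ Z Z))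
      (ContinuousLinearMap.id ℂ _ - (2 : ℂ)⁻¹ • ((H46L F n K h c₀ cB a U₀).comp (avgHess F n K h U₀ Z₀ + (avgHess F n K h U₀).flip Z₀))) Z₀ := by
  have h1 : HasFDerivAt (fun Z : PBond (F.P K) 0 → Matrix (Fin 2) (Fin 2) ℂ => H46L F n K h c₀ cB a U₀ (avgHess F n K h U₀ Z Z))
      ((H46L F n K h c₀ cB a U₀).comp (avgHess F n K h U₀ Z₀ + (avgHess F n K h U₀).flip Z₀)) Z₀ :=
    (H46L F n K h c₀ cB a U₀).hasFDerivAt.comp Z₀ (hasFDerivAt_bilin_diag (avgHess F n K h U₀) Z₀)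
  exact (hasFDerivAt_id Z₀).sub (h1.const_smul (2 : ℂ)⁻¹)

/-- The derivative family is an affine function of the base point: `DΦ_H(Z) = 1 − ½·((compL H46) ∘ (q + qᵀ)) Z`. [folklore] -/
theorem fderiv_reparamJ_eq (Z : PBond (F.P K) 0 → Matrix (Fin 2) (Fin 2) ℂ) :
    fderiv ℂ (fun Z' : PBond (F.P K) 0 → Matrix (Fin 2) (Fin 2) ℂ => Z' - (2 : ℂ)⁻¹ • H46L F n K h c₀ cB a U₀ (avgHess F n K h U₀ Z' Z')) Z =
      ContinuousLinearMap.id ℂ _ - (2 : ℂ)⁻¹ •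
        ((ContinuousLinearMap.compL ℂ (PBond (F.P K) 0 → Matrix (Fin 2) (Fin 2) ℂ) (PBond (F.P n) 0 → Matrix (Fin 2) (Fin 2) ℂ) (PBond (F.P K) 0 → Matrix (Fin 2) (Fin 2) ℂ)
          (H46L F n K h c₀ cB a U₀)).comp (avgHess F n K h U₀ + (avgHess F n K h U₀).flip)) Z := by
  rw [(hasFDerivAt_reparamJ U₀ Z).fderiv]
  rfl

/-- `DΦ_H(0) = 1`. [cite: Balaban1985BackgroundPropagators, (3.127) p.421] -/
theorem fderiv_reparamJ_zero :
    fderiv ℂ (fun Z : PBond (F.P K) 0 → Matrix (Fin 2) (Fin 2) ℂ => Z - (2 : ℂ)⁻¹ • H46L F n K h c₀ cB a U₀ (avgHess F n K h U₀ Z Z)) 0 = ContinuousLinearMap.id ℂ _ := by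
  rw [(hasFDerivAt_reparamJ U₀ 0).fderiv]
  ext1 W
  simp

/-- `Z ↦ DΦ_H(Z)` is affine, with derivative `−½·H46 ∘ (q + qᵀ)` at `0`. [cite: Balaban1985BackgroundPropagators, (3.127) p.421] -/
theorem hasFDerivAt_fderiv_reparamJ :
    HasFDerivAt (fun Z : PBond (F.P K) 0 → Matrix (Fin 2) (Fin 2) ℂ => fderiv ℂ (fun Z' : PBond (F.P K) 0 → Matrix (Fin 2) (Fin 2) ℂ =>
        Z' - (2 : ℂ)⁻¹ • H46L F n K h c₀ cB a U₀ (avgHess F n K h U₀ Z' Z')) Z)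
      (-((2 : ℂ)⁻¹ • ((ContinuousLinearMap.compL ℂ (PBond (F.P K) 0 → Matrix (Fin 2) (Fin 2) ℂ) (PBond (F.P n) 0 → Matrix (Fin 2) (Fin 2) ℂ) (PBond (F.P K) 0 → Matrix (Fin 2) (Fin 2) ℂ)
          (H46L F n K h c₀ cB a U₀)).comp (avgHess F n K h U₀ + (avgHess F n K h U₀).flip)))) 0 := by
  have hfun : (fun Z : PBond (F.P K) 0 → Matrix (Fin 2) (Fin 2) ℂ => fderiv ℂ (fun Z' : PBond (F.P K) 0 → Matrix (Fin 2) (Fin 2) ℂ =>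
        Z' - (2 : ℂ)⁻¹ • H46L F n K h c₀ cB a U₀ (avgHess F n K h U₀ Z' Z')) Z) =
      fun Z => ContinuousLinearMap.id ℂ _ - (2 : ℂ)⁻¹ •
        ((ContinuousLinearMap.compL ℂ (PBond (F.P K) 0 → Matrix (Fin 2) (Fin 2) ℂ) (PBond (F.P n) 0 → Matrix (Fin 2) (Fin 2) ℂ) (PBond (F.P K) 0 → Matrix (Fin 2) (Fin 2) ℂ)
          (H46L F n K h c₀ cB a U₀)).comp (avgHess F n K h U₀ + (avgHess F n K h U₀).flip)) Z :=
    funext fun Z => fderiv_reparamJ_eq U₀ Z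
  rw [hfun]
  have h := (hasFDerivAt_const (ContinuousLinearMap.id ℂ (PBond (F.P K) 0 → Matrix (Fin 2) (Fin 2) ℂ)) (0 : PBond (F.P K) 0 → Matrix (Fin 2) (Fin 2) ℂ)).sub
    ((((ContinuousLinearMap.compL ℂ (PBond (F.P K) 0 → Matrix (Fin 2) (Fin 2) ℂ) (PBond (F.P n) 0 → Matrix (Fin 2) (Fin 2) ℂ) (PBond (F.P K) 0 → Matrix (Fin 2) (Fin 2) ℂ)
          (H46L F n K h c₀ cB a U₀)).comp (avgHess F n K h U₀ + (avgHess F n K h U₀).flip)).hasFDerivAt).const_smul (2 : ℂ)⁻¹)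
  rwa [zero_sub] at h

/-- The second jet, evaluated: `D²Φ_H(0)[X, Y] = −½·H46(q[X, Y] + q[Y, X])`. [cite: Balaban1985BackgroundPropagators, (3.127) p.421] -/
theorem reparamJ_snd_apply (X Y : PBond (F.P K) 0 → Matrix (Fin 2) (Fin 2) ℂ) :
    (-((2 : ℂ)⁻¹ • ((ContinuousLinearMap.compL ℂ (PBond (F.P K) 0 → Matrix (Fin 2) (Fin 2) ℂ) (PBond (F.P n) 0 → Matrix (Fin 2) (Fin 2) ℂ) (PBond (F.P K) 0 → Matrix (Fin 2) (Fin 2) ℂ)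
        (H46L F n K h c₀ cB a U₀)).comp (avgHess F n K h U₀ + (avgHess F n K h U₀).flip)))) X Y =
      -((2 : ℂ)⁻¹ • H46 F n K h c₀ cB a U₀ (avgHess F n K h U₀ X Y + avgHess F n K h U₀ Y X)) := by
  simp only [neg_apply, smul_apply, ContinuousLinearMap.comp_apply, ContinuousLinearMap.compL_apply, add_apply, ContinuousLinearMap.flip_apply,
    map_add, H46L_apply]

end Chart

/-! ## §3 The certificate: `h + t_J` is the action's Hessian in the chart `Φ_H`, and the averaging constraint has no quadratic term there -/

section Certificate

variable {F : T3Family} {n K : ℕ} {h : n ≤ K} {c₀ cB a : ℝ} [Fact (0 < c₀)] [Fact (0 < cB)]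
variable (U₀ : GaugeField (F.P K) 0 (Matrix.specialUnitaryGroup (Fin 2) ℂ))

/-- ★★★ **THE ACTION'S HESSIAN IN THE CONSTRAINT-LINEARISING CHART IS `h + ½(t_J + t_Jᵀ)`** — and `h + t_J` when `C⁽²⁾` is symmetric (below): `D²(𝒜 ∘ Φ_H)(0)[X, Y] = hessFormRe X Y + ½(tjForm X Y + tjForm Y X)`,
`𝒜 = actionRe ∘ chartU U₀`, `Φ_H(Z) = Z − ½·H46(avgHess Z Z)` (print p. 421: «a linearizing transformation creates new quadratic terms … connected with the linear term in (3.12)»).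
[cite: Balaban1985BackgroundPropagators, (3.127) p.421, (3.12) p.392] -/
theorem fderiv_fderiv_actionRe_comp_reparamJ (X Y : PBond (F.P K) 0 → Matrix (Fin 2) (Fin 2) ℂ) :
    fderiv ℂ (fun Z => fderiv ℂ ((fun W : PBond (F.P K) 0 → Matrix (Fin 2) (Fin 2) ℂ => actionRe F K (chartU F K U₀ W)) ∘
        (fun Z' : PBond (F.P K) 0 → Matrix (Fin 2) (Fin 2) ℂ => Z' - (2 : ℂ)⁻¹ • H46L F n K h c₀ cB a U₀ (avgHess F n K h U₀ Z' Z'))) Z) 0 X Y =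
      hessFormRe F K U₀ X Y + (2 : ℂ)⁻¹ * (tjForm F n K h c₀ cB a U₀ X Y + tjForm F n K h c₀ cB a U₀ Y X) := by
  have hf : ContDiff ℂ ⊤ (fun W : PBond (F.P K) 0 → Matrix (Fin 2) (Fin 2) ℂ => actionRe F K (chartU F K U₀ W)) := contDiff_actionRe_chartU U₀
  have hfd : ∀ᶠ Z in 𝓝 (0 : PBond (F.P K) 0 → Matrix (Fin 2) (Fin 2) ℂ), DifferentiableAt ℂ (fun W : PBond (F.P K) 0 → Matrix (Fin 2) (Fin 2) ℂ => actionRe F K (chartU F K U₀ W))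
      (Z - (2 : ℂ)⁻¹ • H46L F n K h c₀ cB a U₀ (avgHess F n K h U₀ Z Z)) :=
    Filter.Eventually.of_forall fun Z => hf.differentiable (by simp) _
  have hf2 : HasFDerivAt (fun W => fderiv ℂ (fun W : PBond (F.P K) 0 → Matrix (Fin 2) (Fin 2) ℂ => actionRe F K (chartU F K U₀ W)) W) (hessFormRe F K U₀) 0 := by
    have h1 : ContDiff ℂ 2 (fun W : PBond (F.P K) 0 → Matrix (Fin 2) (Fin 2) ℂ => actionRe F K (chartU F K U₀ W)) := hf.of_le le_top
    have h2 := (h1.fderiv_right (m := 1) (by norm_num)).differentiable (by norm_num) 0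
    exact h2.hasFDerivAt
  have hΦ0 : (0 : PBond (F.P K) 0 → Matrix (Fin 2) (Fin 2) ℂ) - (2 : ℂ)⁻¹ • H46L F n K h c₀ cB a U₀ (avgHess F n K h U₀ 0 0) = 0 := by simp
  rw [fderiv_fderiv_comp_of_deriv_id hΦ0
    (fun Z => (hasFDerivAt_reparamJ U₀ Z).differentiableAt) (fderiv_reparamJ_zero U₀) (hasFDerivAt_fderiv_reparamJ U₀) hfd hf2,
    reparamJ_snd_apply, ← actionGrad_def, map_neg, map_smul, map_add, map_add, tjForm_apply, tjForm_apply, smul_eq_mul]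
  ring

/-- ★★★ **… `= hessFormRe X Y + tjForm X Y` WHEN `C⁽²⁾` IS SYMMETRIC** (`hAs`; at `U₀ ∈ 𝔘_k(ε₀)` this is ✓`fderiv_fderiv_logChartTwS_symm_of_regPr`): print's (3.127) form `⟨A, ΔA⟩ − 2⟨HC⁽²⁾(A), J⟩` IS the
Hessian of the action in the chart where the averaging is linear. [cite: Balaban1985BackgroundPropagators, (3.127) p.421] -/
theorem hessFormRe_add_tjForm_eq (hAs : ∀ X Y : PBond (F.P K) 0 → Matrix (Fin 2) (Fin 2) ℂ, avgHess F n K h U₀ X Y = avgHess F n K h U₀ Y X)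
    (X Y : PBond (F.P K) 0 → Matrix (Fin 2) (Fin 2) ℂ) :
    hessFormRe F K U₀ X Y + tjForm F n K h c₀ cB a U₀ X Y =
      fderiv ℂ (fun Z => fderiv ℂ ((fun W : PBond (F.P K) 0 → Matrix (Fin 2) (Fin 2) ℂ => actionRe F K (chartU F K U₀ W)) ∘
        (fun Z' : PBond (F.P K) 0 → Matrix (Fin 2) (Fin 2) ℂ => Z' - (2 : ℂ)⁻¹ • H46L F n K h c₀ cB a U₀ (avgHess F n K h U₀ Z' Z'))) Z) 0 X Y := by
  rw [fderiv_fderiv_actionRe_comp_reparamJ, tjForm_apply, tjForm_apply, hAs Y X]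
  ring

/-- ★★★ **THE AVERAGING CONSTRAINT HAS NO QUADRATIC TERM IN THE CHART `Φ_H`** on the class `Q∘H = 1` (`PosOnto … DeltaPiSlot U₀`, ✓`QTwS_Hf`), for the log-chart analytic near `0`:
`D²(log U̿^{twS} ∘ Φ_H)(0)[X, Y] = ½(q[X, Y] − q[Y, X])`, hence `0` when `C⁽²⁾` is symmetric. [cite: Balaban1985BackgroundPropagators, (3.14) p.393, (3.127) p.421; Balaban1985Variational, (47)–(48) p.285] -/
theorem fderiv_fderiv_logChartTwS_comp_reparamJ (hp : PosOnto F n K h c₀ cB a (DeltaPiSlot F n K h c₀ cB a) U₀)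
    {ρ : ℝ} (hρ : 0 < ρ) (hL : AnalyticOnNhd ℂ (logChartTwS F n K h U₀) (ball (0 : PBond (F.P K) 0 → Matrix (Fin 2) (Fin 2) ℂ) ρ))
    (X Y : PBond (F.P K) 0 → Matrix (Fin 2) (Fin 2) ℂ) :
    fderiv ℂ (fun Z => fderiv ℂ (logChartTwS F n K h U₀ ∘
        (fun Z' : PBond (F.P K) 0 → Matrix (Fin 2) (Fin 2) ℂ => Z' - (2 : ℂ)⁻¹ • H46L F n K h c₀ cB a U₀ (avgHess F n K h U₀ Z' Z'))) Z) 0 X Y =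
      (2 : ℂ)⁻¹ • (avgHess F n K h U₀ X Y - avgHess F n K h U₀ Y X) := by
  -- `Φ_H` is continuous at `0` with `Φ_H 0 = 0`, so `Φ_H Z` stays in the analyticity ball near `0`
  have hΦc : ContinuousAt (fun Z' : PBond (F.P K) 0 → Matrix (Fin 2) (Fin 2) ℂ => Z' - (2 : ℂ)⁻¹ • H46L F n K h c₀ cB a U₀ (avgHess F n K h U₀ Z' Z')) 0 :=
    (hasFDerivAt_reparamJ U₀ 0).continuousAt
  have hΦ0 : (0 : PBond (F.P K) 0 → Matrix (Fin 2) (Fin 2) ℂ) - (2 : ℂ)⁻¹ • H46L F n K h c₀ cB a U₀ (avgHess F n K h U₀ 0 0) = 0 := by simp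
  have hfd : ∀ᶠ Z in 𝓝 (0 : PBond (F.P K) 0 → Matrix (Fin 2) (Fin 2) ℂ), DifferentiableAt ℂ (logChartTwS F n K h U₀)
      (Z - (2 : ℂ)⁻¹ • H46L F n K h c₀ cB a U₀ (avgHess F n K h U₀ Z Z)) := by
    have hmem : ∀ᶠ Z in 𝓝 (0 : PBond (F.P K) 0 → Matrix (Fin 2) (Fin 2) ℂ),
        (Z - (2 : ℂ)⁻¹ • H46L F n K h c₀ cB a U₀ (avgHess F n K h U₀ Z Z)) ∈ ball (0 : PBond (F.P K) 0 → Matrix (Fin 2) (Fin 2) ℂ) ρ := by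
      exact hΦc.preimage_mem_nhds (by rw [hΦ0]; exact ball_mem_nhds 0 hρ)
    filter_upwards [hmem] with Z hZ
    exact (hL _ hZ).differentiableAt
  have hf2 : HasFDerivAt (fun W => fderiv ℂ (logChartTwS F n K h U₀) W) (avgHess F n K h U₀) 0 := by
    rw [avgHess_def]
    exact ((hL.fderiv) 0 (mem_ball_self hρ)).differentiableAt.hasFDerivAt
  rw [fderiv_fderiv_comp_of_deriv_id hΦ0 (fun Z => (hasFDerivAt_reparamJ U₀ Z).differentiableAt) (fderiv_reparamJ_zero U₀) (hasFDerivAt_fderiv_reparamJ U₀) hfd hf2,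
    reparamJ_snd_apply, ← QTwS_def, map_neg, map_smul, QTwS_Hf hp]
  module

/-- ★★★ **AT `U₀ ∈ 𝔘_k(ε₀)` (windows `10⁹L²e ≤ 1`, `10¹²L³ε₀ ≤ 1`) ON THE CLASS `Q∘H = 1`: the action's Hessian in the chart `Φ_H` IS `h + t_J` AND the averaging has NO quadratic term there** —
the two facts that make `Δ^η + T_J` print's (3.127). [cite: Balaban1985BackgroundPropagators, (3.127) p.421, (3.14) p.393] -/
theorem reparamJ_certificate_of_regPr [Fact (0 < (F.L : ℝ))] [Fact (0 < ((F.L : ℝ)⁻¹) ^ (K - n))]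
    {ε₀ e : ℝ} (hε₀ : 0 < ε₀) (he : 0 < e) (hWe : 10 ^ 9 * (F.L : ℝ) ^ 2 * e ≤ 1) (hWε : 10 ^ 12 * (F.L : ℝ) ^ 3 * ε₀ ≤ 1) (hreg : RegPr F n K ε₀ U₀)
    (hp : PosOnto F n K h c₀ cB a (DeltaPiSlot F n K h c₀ cB a) U₀) (X Y : PBond (F.P K) 0 → Matrix (Fin 2) (Fin 2) ℂ) :
    fderiv ℂ (fun Z => fderiv ℂ ((fun W : PBond (F.P K) 0 → Matrix (Fin 2) (Fin 2) ℂ => actionRe F K (chartU F K U₀ W)) ∘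
        (fun Z' : PBond (F.P K) 0 → Matrix (Fin 2) (Fin 2) ℂ => Z' - (2 : ℂ)⁻¹ • H46L F n K h c₀ cB a U₀ (avgHess F n K h U₀ Z' Z'))) Z) 0 X Y =
        hessFormRe F K U₀ X Y + tjForm F n K h c₀ cB a U₀ X Y ∧
      fderiv ℂ (fun Z => fderiv ℂ (logChartTwS F n K h U₀ ∘
        (fun Z' : PBond (F.P K) 0 → Matrix (Fin 2) (Fin 2) ℂ => Z' - (2 : ℂ)⁻¹ • H46L F n K h c₀ cB a U₀ (avgHess F n K h U₀ Z' Z'))) Z) 0 X Y = 0 := by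
  have hAs : ∀ X Y : PBond (F.P K) 0 → Matrix (Fin 2) (Fin 2) ℂ, avgHess F n K h U₀ X Y = avgHess F n K h U₀ Y X := fun X Y => by
    rw [avgHess_def]; exact fderiv_fderiv_logChartTwS_symm_of_regPr F h hε₀ he hWe hWε U₀ hreg X Y
  refine ⟨(hessFormRe_add_tjForm_eq U₀ hAs X Y).symm, ?_⟩
  rw [fderiv_fderiv_logChartTwS_comp_reparamJ U₀ hp (mul_pos he (eta_pos F n K)) (analyticOnNhd_logChartTwS F h hε₀ he hWe hWε U₀ hreg), hAs X Y, sub_self, smul_zero]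

end Certificate

end Summit.QuantumFields.YangMills.Theorems.Prop7SectET3DeltaOne

end
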